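import Literature.Probability.Percolation.TriQuadProtection
import Literature.Probability.Percolation.TriQuadStagesBK
import HarnessLib

/-!
# Locality of the stage construction: configurations agreeing on the quad

Topic `Literature/Probability/Percolation`; family `crit-perc`, statement **crit-perc.S16**
(`Literature.Probability.Percolation.triTheta_exponent`). Bookkeeping for Kesten's arm separation
in P. Nolin's form (EJP 13 (2008), §4.4, proof of Lemma 15 [arXiv 0711.4948: Lemma 14]): every
object of the two-colour stage construction of a lattice quad `Q` (`TriQuadStages.lean`,
`TriQuadStagesBK.lean`, `TriQuadProtection.lean`) only depends on the trace of the configuration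
on the sites `Q.U` of the quad — the examined sets `N_u` and `openStop`, the existence of crossings
avoiding them, the number of stages, the canonical sets and hence the canonical crossings and their
tips, and the protection events (which force every site off `U`). This is what allows the
free-space sites inside the inner half-box to be resampled given the data on `U`
(`StoppingSetDecoupling.lean`).

## References

* P. Nolin, Near-critical percolation in two dimensions, *Electron. J. Probab.* 13 (2008), §4.3
  Lemma 12, §4.4 proof of Lemma 15 [arXiv 0711.4948: Lemma 11, Lemma 14] [Nolin2008].

## Mathlib / tree

Tree: `TriQuad.isStoppingSet_stages`, `stages_subset`, `stages_compl` (`TriQuadStages.lean`),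
`isStoppingSet_openStop`, `openStop_subset`, `canonSet_eq_of_agree`, `ProtO`, `triForcedFrame`
(`TriQuadProtection.lean`, `TriForcedFrame.lean`), `Stopped`, `numStages`, `stopped_numStages`
`lrPath_or_of_lt_numStages`, `lt_numStages_of_lrPath` (`TriQuadStagesBK.lean`), `LRPath_congr`
(`TriLowestCrossingSwitch.lean`).
-/

noncomputable section

open Set

namespace Literature.Probability.Percolation

open LatticeModels

namespace TriQuad

variable {Q : TriQuad} {χ χ' : Set (Site 2)}

/-- Agreement on `U` passes to complements. [folklore] -/
theorem compl_agree (h : ∀ v ∈ Q.U, v ∈ χ ↔ v ∈ χ') : ∀ v ∈ Q.U, v ∈ χᶜ ↔ v ∈ χ'ᶜ :=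
  fun v hv => not_congr (h v hv)

/-- The examined sets only depend on the trace on `U`. [cite: Nolin2008, §4.4, proof of Lemma 15 (arXiv 0711.4948: Lemma 14)] -/
theorem stages_congr (h : ∀ v ∈ Q.U, v ∈ χ ↔ v ∈ χ') (u : ℕ) : Q.stages χ' u = Q.stages χ u :=
  isStoppingSet_stages (Q := Q) u χ χ' fun v hv => h v (stages_subset χ u hv)

/-- `openStop` only depends on the trace on `U`. [folklore] -/
theorem openStop_congr (h : ∀ v ∈ Q.U, v ∈ χ ↔ v ∈ χ') (u : ℕ) : Q.openStop χ' u = Q.openStop χ u :=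
  isStoppingSet_openStop (Q := Q) u χ χ' fun v hv => h v (openStop_subset χ u hv)

/-- Crossings avoiding `N_u` only depend on the trace on `U`. [folklore] -/
theorem lrPath_sdiff_stages_congr (h : ∀ v ∈ Q.U, v ∈ χ ↔ v ∈ χ') (u : ℕ) :
    Q.LRPath (χ \ ↑(Q.stages χ u)) ↔ Q.LRPath (χ' \ ↑(Q.stages χ' u)) := by
  rw [stages_congr h u]
  exact LRPath_congr fun z hz => by simp only [mem_sdiff, h z hz]

/-- Stopping only depends on the trace on `U`. [folklore] -/
theorem stopped_congr (h : ∀ v ∈ Q.U, v ∈ χ ↔ v ∈ χ') (t : ℕ) : Q.Stopped χ t ↔ Q.Stopped χ' t := by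
  have h' := lrPath_sdiff_stages_congr (Q := Q) (compl_agree h) t
  rw [stages_compl, stages_compl] at h'
  unfold Stopped
  rw [lrPath_sdiff_stages_congr h t, h']

/-- The number of stages only depends on the trace on `U`. [folklore] -/
theorem numStages_congr (h : ∀ v ∈ Q.U, v ∈ χ ↔ v ∈ χ') : Q.numStages χ' = Q.numStages χ := by
  have key : ∀ {χ χ' : Set (Site 2)}, (∀ v ∈ Q.U, v ∈ χ ↔ v ∈ χ') → Q.numStages χ ≤ Q.numStages χ' := by
    intro χ χ' h
    by_contra hlt
    push Not at hlt
    have hor := lrPath_or_of_lt_numStages (Q := Q) hlt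
    have h1 := lrPath_sdiff_stages_congr h (Q.numStages χ')
    have h2 := lrPath_sdiff_stages_congr (Q := Q) (compl_agree h) (Q.numStages χ')
    rw [stages_compl, stages_compl] at h2
    have : Q.LRPath (χ' \ ↑(Q.stages χ' (Q.numStages χ'))) ∨
        Q.LRPath (χ'ᶜ \ ↑(Q.stages χ' (Q.numStages χ'))) := by
      rcases hor with h' | h'
      · exact Or.inl (h1.1 h')
      · exact Or.inr (h2.1 h')
    exact lt_irrefl _ (lt_numStages_of_lrPath this)
  exact le_antisymm (key fun v hv => (h v hv).symm) (key h)

/-- The canonical sets only depend on the trace on `U`. [folklore] -/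
theorem canonSet_congr (h : ∀ v ∈ Q.U, v ∈ χ ↔ v ∈ χ') (u : ℕ) : Q.canonSet χ' u = Q.canonSet χ u :=
  canonSet_eq_of_agree fun v hv => h v (openStop_subset χ u hv)

/-- Forcing everything off `U`: the forced configuration only depends on the trace on `U`. [folklore] -/
theorem union_forcing_congr (h : ∀ v ∈ Q.U, v ∈ χ ↔ v ∈ χ') (D : Set (Site 2)) :
    χ ∪ (D ∪ (↑Q.U)ᶜ) = χ' ∪ (D ∪ (↑Q.U)ᶜ) := by
  ext v
  by_cases hv : v ∈ (↑Q.U : Set (Site 2))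
  · simp only [mem_union, mem_compl_iff, hv, not_true_eq_false, or_false, h v hv]
  · simp only [mem_union, mem_compl_iff, hv, not_false_eq_true, or_true]

/-- The protection event only depends on the trace on `U`. [cite: Nolin2008, §4.4, proof of Lemma 15 (arXiv 0711.4948: Lemma 14)] -/
theorem protO_congr (h : ∀ v ∈ Q.U, v ∈ χ ↔ v ∈ χ') {K M₀ : ℕ} {u : ℕ} :
    Q.ProtO K M₀ χ u ↔ Q.ProtO K M₀ χ' u := by
  unfold ProtO triForcedFrame
  simp only [mem_setOf_eq]
  rw [openStop_congr h u, canonSet_congr h u, union_forcing_congr h]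

end TriQuad

end Literature.Probability.Percolation
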